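import Summits.AtomisticToContinuum.Crystallization.Theorems.HolmgrenBoyleLindFLCEquilibriumPeriodic
import Summits.AtomisticToContinuum.Crystallization.Theorems.ExcessDecayLiouvilleForceTail

/-!
# Route `HolmgrenBoyleLind`: patch-hull elements of an FLC Delone Lennard-Jones equilibrium, part 1

Support file for item stmt-AtomisticToContinuum-6079 (`FLCEquilibriumPeriodic`, equivalent to the
crux `HalfSpaceUniqueContinuation` granted `HalfSpaceRigidityPeriodic`, see
`HolmgrenBoyleLindFLCEquilibriumPeriodic.lean`). The crux quantifies over elements `ω` of the
PATCH-HULL of `Λ` (every closed ball of `ω` about `0` is an exact translate of a patch of `Λ`: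
`∀ R, ∃ v, {z ∈ ω | ‖z‖ ≤ R} = {z | z + v ∈ Λ ∧ ‖z‖ ≤ R}`), while its hypotheses (separation,
relative density, finite local complexity, force balance) are stated for `Λ` only. This file is the
transfer — the route's "hull infrastructure … hull elements of an equilibrium are equilibria — an
`O(R⁻⁴)` tail lemma" (Theses docstring, NOT DECOMPOSED YET):

* `hbl_hull_separated`, `hbl_hull_dense`, `hbl_hull_patches_subset`, `hbl_hull_flc` — a patch-hull
  element of a `δ`-separated / `r`-dense / FLC set is `δ`-separated / `r`-dense / FLC (its patches
  are patches of `Λ`);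
* `hbl_finite_near` — a `δ`-separated set has finitely many points in every ball (packing,
  `card_le_of_separated_of_dist_le`);
* `hbl_summable_norm_ljForce` — over a `δ`-separated `X ∋ p` the Lennard-Jones forces on `p` are
  absolutely summable (near points: finitely many, each `≤ δ⁻¹³ + δ⁻⁷`; far points: the `r⁻⁷` tail
  `sum_norm_ljForce_le_of_separated` of route `ExcessDecayLiouville`);
* `hbl_norm_tsum_sub_sum_le` — the full force minus the force of the points at distance `< R` has
  norm `≤ 2048/(δ³R⁴)` (`R ≥ max δ 1`);
* part 2 (`HolmgrenBoyleLindHullBalance.lean`): hull elements of an equilibrium are equilibria, and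
  `HalfSpaceUniqueContinuation` with the hull hypotheses made explicit.

All `[folklore]`; nothing here closes an item.
-/

noncomputable section

namespace Summit.AtomisticToContinuum.Crystallization.Theorems

open scoped BigOperators Topology
open Literature.MathematicalPhysics.StatisticalMechanics
open Summit.AtomisticToContinuum.Crystallization.Theorems.ExcessDecayLiouville

/-! ## Patch-hull elements inherit separation, density and finite local complexity -/

section Hull

variable {Λ ω : Set (EuclideanSpace ℝ (Fin 3))}

/-- A patch-hull element of a `δ`-separated set is `δ`-separated. [folklore] -/
theorem hbl_hull_separated {δ : ℝ} (hsep : ∀ x ∈ Λ, ∀ y ∈ Λ, x ≠ y → δ ≤ dist x y)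
    (hω : ∀ R : ℝ, ∃ v : (EuclideanSpace ℝ (Fin 3)), {z : (EuclideanSpace ℝ (Fin 3)) | z ∈ ω ∧ ‖z‖ ≤ R} = {z : (EuclideanSpace ℝ (Fin 3)) | z + v ∈ Λ ∧ ‖z‖ ≤ R}) :
    ∀ x ∈ ω, ∀ y ∈ ω, x ≠ y → δ ≤ dist x y := by
  intro x hx y hy hxy
  obtain ⟨v, hv⟩ := hω (max ‖x‖ ‖y‖)
  have hx' := (hbl_mem_iff_of_patch_eq (T := {z : (EuclideanSpace ℝ (Fin 3)) | z + v ∈ Λ}) hv (le_max_left _ _)).1 hx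
  have hy' := (hbl_mem_iff_of_patch_eq (T := {z : (EuclideanSpace ℝ (Fin 3)) | z + v ∈ Λ}) hv (le_max_right _ _)).1 hy
  simp only [Set.mem_setOf_eq] at hx' hy'
  have h := hsep (x + v) hx' (y + v) hy' (fun h => hxy (add_right_cancel h))
  rwa [dist_add_right] at h

/-- A patch-hull element of an `r`-dense set is `r`-dense. [folklore] -/
theorem hbl_hull_dense {r : ℝ} (hden : ∀ c : (EuclideanSpace ℝ (Fin 3)), ∃ y ∈ Λ, dist y c ≤ r)
    (hω : ∀ R : ℝ, ∃ v : (EuclideanSpace ℝ (Fin 3)), {z : (EuclideanSpace ℝ (Fin 3)) | z ∈ ω ∧ ‖z‖ ≤ R} = {z : (EuclideanSpace ℝ (Fin 3)) | z + v ∈ Λ ∧ ‖z‖ ≤ R}) :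
    ∀ c : (EuclideanSpace ℝ (Fin 3)), ∃ y ∈ ω, dist y c ≤ r := by
  intro c
  obtain ⟨v, hv⟩ := hω (‖c‖ + r)
  obtain ⟨y, hy, hyc⟩ := hden (c + v)
  have hd : dist (y - v) c = dist y (c + v) := by
    rw [dist_eq_norm, dist_eq_norm]
    congr 1
    abel
  refine ⟨y - v, ?_, by rwa [hd]⟩
  have hn : ‖y - v‖ ≤ ‖c‖ + r := by
    have h1 : ‖y - v‖ ≤ ‖y - v - c‖ + ‖c‖ := by
      have := norm_add_le (y - v - c) c
      rwa [sub_add_cancel] at this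
    rw [← dist_eq_norm (y - v) c, hd] at h1
    linarith
  have hmem : y - v ∈ {z : (EuclideanSpace ℝ (Fin 3)) | z + v ∈ Λ} := by
    simp only [Set.mem_setOf_eq, sub_add_cancel]
    exact hy
  exact (hbl_mem_iff_of_patch_eq (T := {z : (EuclideanSpace ℝ (Fin 3)) | z + v ∈ Λ}) hv hn).2 hmem

/-- The `R`-patches of a patch-hull element are `R`-patches of `Λ`. [folklore] -/
theorem hbl_hull_patches_subset
    (hω : ∀ R : ℝ, ∃ v : (EuclideanSpace ℝ (Fin 3)), {z : (EuclideanSpace ℝ (Fin 3)) | z ∈ ω ∧ ‖z‖ ≤ R} = {z : (EuclideanSpace ℝ (Fin 3)) | z + v ∈ Λ ∧ ‖z‖ ≤ R})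
    (R : ℝ) :
    {S : Set (EuclideanSpace ℝ (Fin 3)) | ∃ x ∈ ω, S = {u : (EuclideanSpace ℝ (Fin 3)) | x + u ∈ ω ∧ ‖u‖ ≤ R}} ⊆
      {S : Set (EuclideanSpace ℝ (Fin 3)) | ∃ x ∈ Λ, S = {u : (EuclideanSpace ℝ (Fin 3)) | x + u ∈ Λ ∧ ‖u‖ ≤ R}} := by
  rintro S ⟨x, hx, rfl⟩
  obtain ⟨v, hv⟩ := hω (‖x‖ + |R|)
  have hx0 : ‖x‖ ≤ ‖x‖ + |R| := le_add_of_nonneg_right (abs_nonneg R)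
  have hxΛ := (hbl_mem_iff_of_patch_eq (T := {z : (EuclideanSpace ℝ (Fin 3)) | z + v ∈ Λ}) hv hx0).1 hx
  simp only [Set.mem_setOf_eq] at hxΛ
  refine ⟨x + v, hxΛ, Set.ext fun u => ?_⟩
  simp only [Set.mem_setOf_eq]
  constructor
  · rintro ⟨hu, huR⟩
    refine ⟨?_, huR⟩
    have hn : ‖x + u‖ ≤ ‖x‖ + |R| :=
      (norm_add_le x u).trans (add_le_add le_rfl (huR.trans (le_abs_self R)))
    have h := (hbl_mem_iff_of_patch_eq (T := {z : (EuclideanSpace ℝ (Fin 3)) | z + v ∈ Λ}) hv hn).1 hu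
    simp only [Set.mem_setOf_eq] at h
    rwa [add_right_comm] at h
  · rintro ⟨hu, huR⟩
    refine ⟨?_, huR⟩
    have hn : ‖x + u‖ ≤ ‖x‖ + |R| :=
      (norm_add_le x u).trans (add_le_add le_rfl (huR.trans (le_abs_self R)))
    refine (hbl_mem_iff_of_patch_eq (T := {z : (EuclideanSpace ℝ (Fin 3)) | z + v ∈ Λ}) hv hn).2 ?_
    simp only [Set.mem_setOf_eq]
    rwa [add_right_comm]

/-- A patch-hull element of a set of finite local complexity has finite local complexity.
[folklore] -/
theorem hbl_hull_flc
    (hFLC : ∀ R : ℝ, Set.Finite {S : Set (EuclideanSpace ℝ (Fin 3)) | ∃ x ∈ Λ, S = {u : (EuclideanSpace ℝ (Fin 3)) | x + u ∈ Λ ∧ ‖u‖ ≤ R}})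
    (hω : ∀ R : ℝ, ∃ v : (EuclideanSpace ℝ (Fin 3)), {z : (EuclideanSpace ℝ (Fin 3)) | z ∈ ω ∧ ‖z‖ ≤ R} = {z : (EuclideanSpace ℝ (Fin 3)) | z + v ∈ Λ ∧ ‖z‖ ≤ R}) :
    ∀ R : ℝ, Set.Finite {S : Set (EuclideanSpace ℝ (Fin 3)) | ∃ x ∈ ω, S = {u : (EuclideanSpace ℝ (Fin 3)) | x + u ∈ ω ∧ ‖u‖ ≤ R}} :=
  fun R => (hFLC R).subset (hbl_hull_patches_subset hω R)

end Hull

/-! ## Separated sets: finiteness in balls and summability of the Lennard-Jones forces -/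

/-- A `δ`-separated set has finitely many points within distance `R` of any point (packing by
volume, `card_le_of_separated_of_dist_le`). [folklore] -/
theorem hbl_finite_near {X : Set (EuclideanSpace ℝ (Fin 3))} {δ : ℝ} (hδ : 0 < δ)
    (hsep : ∀ a ∈ X, ∀ b ∈ X, a ≠ b → δ ≤ dist a b) (p : (EuclideanSpace ℝ (Fin 3))) (R : ℝ) :
    {q : (EuclideanSpace ℝ (Fin 3)) | q ∈ X ∧ dist q p ≤ R}.Finite := by
  by_contra hinf
  have hinf : Set.Infinite {q : (EuclideanSpace ℝ (Fin 3)) | q ∈ X ∧ dist q p ≤ R} := hinf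
  rcases lt_or_ge R 0 with hR | hR
  · obtain ⟨q, hq⟩ := hinf.nonempty
    exact (not_le.2 hR) (dist_nonneg.trans hq.2)
  obtain ⟨t, ht, hcard⟩ := hinf.exists_subset_card_eq (⌊(2 * R / δ + 1) ^ 3⌋₊ + 1)
  have hle := card_le_of_separated_of_dist_le t p hδ hR (fun c hc => (ht hc).2)
    (fun c hc d hd hcd => hsep c (ht hc).1 d (ht hd).1 hcd)
  rw [finrank_euclideanSpace_fin, hcard] at hle
  have hlt := Nat.lt_floor_add_one ((2 * R / δ + 1) ^ 3)
  push_cast at hle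
  linarith

/-- Over a `δ`-separated `X ∋ p`, every finite sum of norms of Lennard-Jones forces
`(V′(d)/d)·(p − q)`, `q ∈ X ∖ {p}`, is bounded uniformly: the points at distance `< R₀ := max δ 1`
number `≤ (2R₀/δ + 1)³` and contribute `≤ δ⁻¹³ + δ⁻⁷` each, the others at most the `r⁻⁷` tail
`2048/(δ³R₀⁴)`. [folklore] -/
theorem hbl_sum_norm_ljForce_le {X : Set (EuclideanSpace ℝ (Fin 3))} {δ : ℝ} (hδ : 0 < δ)
    (hsep : ∀ a ∈ X, ∀ b ∈ X, a ≠ b → δ ≤ dist a b) {p : (EuclideanSpace ℝ (Fin 3))} (hp : p ∈ X)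
    (u : Finset {q : (EuclideanSpace ℝ (Fin 3)) // q ∈ X ∧ q ≠ p}) :
    ∑ q ∈ u, ‖(deriv lennardJones (dist p q) / dist p q) • (p - (q : (EuclideanSpace ℝ (Fin 3))))‖ ≤
      (2 * max δ 1 / δ + 1) ^ 3 * ((δ⁻¹) ^ 13 + (δ⁻¹) ^ 7) + 2048 / (δ ^ 3 * (max δ 1) ^ 4) := by
  classical
  have hδR : δ ≤ max δ 1 := le_max_left _ _
  have hR1 : 1 ≤ max δ 1 := le_max_right _ _
  have hR0 : 0 ≤ max δ 1 := zero_le_one.trans hR1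
  have hM0 : 0 ≤ (δ⁻¹) ^ 13 + (δ⁻¹) ^ 7 := by positivity
  rw [← Finset.sum_filter_add_sum_filter_not u
    (fun q : {q : (EuclideanSpace ℝ (Fin 3)) // q ∈ X ∧ q ≠ p} => dist (q : (EuclideanSpace ℝ (Fin 3))) p < max δ 1)]
  refine add_le_add ?_ ?_
  · -- near part: finitely many bounded terms
    have hterm : ∀ q ∈ u.filter (fun q : {q : (EuclideanSpace ℝ (Fin 3)) // q ∈ X ∧ q ≠ p} => dist (q : (EuclideanSpace ℝ (Fin 3))) p < max δ 1),
        ‖(deriv lennardJones (dist p q) / dist p q) • (p - (q : (EuclideanSpace ℝ (Fin 3))))‖ ≤ (δ⁻¹) ^ 13 + (δ⁻¹) ^ 7 := by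
      intro q _
      have hne : p ≠ (q : (EuclideanSpace ℝ (Fin 3))) := fun h => q.2.2 h.symm
      rw [norm_ljForce_eq hne]
      have hd : δ ≤ dist p q := hsep p hp q q.2.1 hne
      have hd0 : 0 < dist p (q : (EuclideanSpace ℝ (Fin 3))) := hδ.trans_le hd
      refine (abs_deriv_lennardJones_le hd0).trans ?_
      have hi : (dist p (q : (EuclideanSpace ℝ (Fin 3))))⁻¹ ≤ δ⁻¹ := (inv_le_inv₀ hd0 hδ).2 hd
      have hi0 : 0 ≤ (dist p (q : (EuclideanSpace ℝ (Fin 3))))⁻¹ := inv_nonneg.2 hd0.le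
      gcongr
    have hcard : ((u.filter (fun q : {q : (EuclideanSpace ℝ (Fin 3)) // q ∈ X ∧ q ≠ p} =>
        dist (q : (EuclideanSpace ℝ (Fin 3))) p < max δ 1)).card : ℝ) ≤ (2 * max δ 1 / δ + 1) ^ 3 := by
      have h := card_le_of_separated_of_dist_le
        ((u.filter (fun q : {q : (EuclideanSpace ℝ (Fin 3)) // q ∈ X ∧ q ≠ p} => dist (q : (EuclideanSpace ℝ (Fin 3))) p < max δ 1)).map
          (Function.Embedding.subtype _)) p hδ hR0 ?_ ?_
      · rwa [Finset.card_map, finrank_euclideanSpace_fin] at h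
      · intro c hc
        simp only [Finset.mem_map, Function.Embedding.coe_subtype] at hc
        obtain ⟨c', hc', rfl⟩ := hc
        rw [Finset.mem_filter] at hc'
        exact hc'.2.le
      · intro c hc d hd hcd
        simp only [Finset.mem_map, Function.Embedding.coe_subtype] at hc hd
        obtain ⟨c', -, rfl⟩ := hc
        obtain ⟨d', -, rfl⟩ := hd
        exact hsep _ c'.2.1 _ d'.2.1 hcd
    refine (Finset.sum_le_sum hterm).trans ?_
    rw [Finset.sum_const, nsmul_eq_mul]
    gcongr
  · -- far part: the `r⁻⁷` tail
    have h := sum_norm_ljForce_le_of_separated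
      ((u.filter (fun q : {q : (EuclideanSpace ℝ (Fin 3)) // q ∈ X ∧ q ≠ p} => ¬ dist (q : (EuclideanSpace ℝ (Fin 3))) p < max δ 1)).map
        (Function.Embedding.subtype _)) p hδ hδR hR1 ?_ ?_
    · rwa [Finset.sum_map] at h
    · intro a ha b hb hab
      simp only [Finset.mem_map, Function.Embedding.coe_subtype] at ha hb
      obtain ⟨a', -, rfl⟩ := ha
      obtain ⟨b', -, rfl⟩ := hb
      exact hsep _ a'.2.1 _ b'.2.1 hab
    · intro a ha
      simp only [Finset.mem_map, Function.Embedding.coe_subtype] at ha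
      obtain ⟨a', ha', rfl⟩ := ha
      rw [Finset.mem_filter] at ha'
      exact not_lt.1 ha'.2

/-- Over a `δ`-separated `X ∋ p` the Lennard-Jones forces `(V′(d)/d)·(p − q)`, `q ∈ X ∖ {p}`, are
absolutely summable (`hbl_sum_norm_ljForce_le`). [folklore] -/
theorem hbl_summable_norm_ljForce {X : Set (EuclideanSpace ℝ (Fin 3))} {δ : ℝ} (hδ : 0 < δ)
    (hsep : ∀ a ∈ X, ∀ b ∈ X, a ≠ b → δ ≤ dist a b) {p : (EuclideanSpace ℝ (Fin 3))} (hp : p ∈ X) :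
    Summable (fun q : {q : (EuclideanSpace ℝ (Fin 3)) // q ∈ X ∧ q ≠ p} =>
      ‖(deriv lennardJones (dist p q) / dist p q) • (p - (q : (EuclideanSpace ℝ (Fin 3))))‖) :=
  summable_of_sum_le (fun _ => norm_nonneg _) (hbl_sum_norm_ljForce_le hδ hsep hp)

/-- **Force tail of the full sum.** Over a `δ`-separated `X ∋ p`, the total Lennard-Jones force on
`p` minus the force of the points at distance `< R` (collected in any finset `A` with the stated
membership) has norm `≤ 2048/(δ³R⁴)` (`0 < δ ≤ R`, `1 ≤ R`). [folklore] -/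
theorem hbl_norm_tsum_sub_sum_le {X : Set (EuclideanSpace ℝ (Fin 3))} {δ R : ℝ} (hδ : 0 < δ) (hδR : δ ≤ R) (hR : 1 ≤ R)
    (hsep : ∀ a ∈ X, ∀ b ∈ X, a ≠ b → δ ≤ dist a b) {p : (EuclideanSpace ℝ (Fin 3))} (hp : p ∈ X) (A : Finset (EuclideanSpace ℝ (Fin 3)))
    (hA : ∀ q : (EuclideanSpace ℝ (Fin 3)), q ∈ A ↔ q ∈ X ∧ q ≠ p ∧ dist q p < R) :
    ‖(∑' q : {q : (EuclideanSpace ℝ (Fin 3)) // q ∈ X ∧ q ≠ p},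
        (deriv lennardJones (dist p q) / dist p q) • (p - (q : (EuclideanSpace ℝ (Fin 3))))) -
      ∑ q ∈ A, (deriv lennardJones (dist p q) / dist p q) • (p - q)‖ ≤ 2048 / (δ ^ 3 * R ^ 4) := by
  classical
  set F : (EuclideanSpace ℝ (Fin 3)) → (EuclideanSpace ℝ (Fin 3)) := fun q => (deriv lennardJones (dist p q) / dist p q) • (p - q) with hF
  have hsumn := hbl_summable_norm_ljForce hδ hsep hp
  have hsum : Summable (fun q : {q : (EuclideanSpace ℝ (Fin 3)) // q ∈ X ∧ q ≠ p} => F q) := hsumn.of_norm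
  set N : Finset {q : (EuclideanSpace ℝ (Fin 3)) // q ∈ X ∧ q ≠ p} := A.subtype (fun q => q ∈ X ∧ q ≠ p) with hN
  have hmemN : ∀ q : {q : (EuclideanSpace ℝ (Fin 3)) // q ∈ X ∧ q ≠ p}, q ∈ N ↔ (q : (EuclideanSpace ℝ (Fin 3))) ∈ A := fun q =>
    Finset.mem_subtype
  have hNA : ∑ q ∈ N, F q = ∑ q ∈ A, F q := by
    have h1 : N.map (Function.Embedding.subtype _) = A := by
      rw [hN, Finset.subtype_map, Finset.filter_true_of_mem]
      intro q hq
      exact ⟨((hA q).1 hq).1, ((hA q).1 hq).2.1⟩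
    conv_rhs => rw [← h1, Finset.sum_map]
    rfl
  have hsplit := hsum.sum_add_tsum_subtype_compl N
  have heq : (∑' q : {q : (EuclideanSpace ℝ (Fin 3)) // q ∈ X ∧ q ≠ p}, F q) - ∑ q ∈ A, F q =
      ∑' q : {q : {q : (EuclideanSpace ℝ (Fin 3)) // q ∈ X ∧ q ≠ p} // q ∉ N}, F q := by
    rw [← hsplit, hNA, add_sub_cancel_left]
  show ‖(∑' q : {q : (EuclideanSpace ℝ (Fin 3)) // q ∈ X ∧ q ≠ p}, F q) - ∑ q ∈ A, F q‖ ≤ 2048 / (δ ^ 3 * R ^ 4)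
  rw [heq]
  have hsn : Summable (fun q : {q : {q : (EuclideanSpace ℝ (Fin 3)) // q ∈ X ∧ q ≠ p} // q ∉ N} => ‖F q‖) :=
    hsumn.subtype (fun q => q ∉ N)
  refine (norm_tsum_le_tsum_norm hsn).trans (hsn.tsum_le_of_sum_le fun u => ?_)
  set emb : {q : {q : (EuclideanSpace ℝ (Fin 3)) // q ∈ X ∧ q ≠ p} // q ∉ N} ↪ (EuclideanSpace ℝ (Fin 3)) :=
    (Function.Embedding.subtype _).trans (Function.Embedding.subtype _) with hemb
  have h := sum_norm_ljForce_le_of_separated (u.map emb) p hδ hδR hR ?_ ?_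
  · rw [Finset.sum_map] at h
    simpa only [hemb, Function.Embedding.trans_apply, Function.Embedding.coe_subtype] using h
  · intro a ha b hb hab
    simp only [Finset.mem_map] at ha hb
    obtain ⟨a', -, rfl⟩ := ha
    obtain ⟨b', -, rfl⟩ := hb
    simp only [hemb, Function.Embedding.trans_apply, Function.Embedding.coe_subtype] at hab ⊢
    exact hsep _ a'.1.2.1 _ b'.1.2.1 hab
  · intro a ha
    simp only [Finset.mem_map] at ha
    obtain ⟨a', -, rfl⟩ := ha
    simp only [hemb, Function.Embedding.trans_apply, Function.Embedding.coe_subtype]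
    have hnot : ((a' : {q : (EuclideanSpace ℝ (Fin 3)) // q ∈ X ∧ q ≠ p}) : (EuclideanSpace ℝ (Fin 3))) ∉ A := fun hmem =>
      a'.2 ((hmemN _).2 hmem)
    have h' : ¬ dist ((a' : {q : (EuclideanSpace ℝ (Fin 3)) // q ∈ X ∧ q ≠ p}) : (EuclideanSpace ℝ (Fin 3))) p < R := fun hlt =>
      hnot ((hA _).2 ⟨a'.1.2.1, a'.1.2.2, hlt⟩)
    exact not_lt.1 h'

end Summit.AtomisticToContinuum.Crystallization.Theorems

end
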